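import Summits.HodgeConjecture.HodgeCM.PerL34.GenuineCoeffMatch_1

/-! PORT of `HodgeCM/PerL34/GenuineCoeffMatch.lean` (HodgeCMPerL run 82) — part 2: continuation of `Summits.HodgeConjecture.HodgeCM.PerL34.GenuineCoeffMatch_1` (split at a top-level declaration boundary by port_pkg.py; scope re-opened below; declarations unchanged). -/

-- port_pkg: scope re-opened for this part (file-level context, then the namespace/section stack open at the cut)
set_option autoImplicit false
noncomputable section
open MeasureTheory MeasureTheory.Measure Set Metric Function Complex ComplexConjugate Topology Filter
open scoped RestrictedProduct InnerProductSpace NNReal ENNReal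
namespace HodgeCM.PerL34.RestrictedTensor.Genuine
open HodgeCM.PerL34.SplitShells HodgeCM.PerL34.AdelicFactorisation HodgeCM.PerL34.RestrictedMeasure
open HodgeCM.PerL34.NoSmallSubgroups HodgeCM.PerL34.EulerFactorisation HodgeCM.PerL34.DiscreteFD
open HodgeCM.PerL34.LocalFactors HodgeCM.PerL34.LocalFactors.DilationModel
open HodgeCM.PerL34.LocalModulus HodgeCM.PerL34.SplitPlaceDilation
open HodgeCM.PerL34.RallisIP HodgeCM.PerL34.Doubling HodgeCM.PerL34.N31d NumberField IsDedekindDomain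
open HodgeCM.PerL34.IdelePlaces HodgeCM.PerL34.RestrictedRegroup HodgeCM.PerL34.RestrictedCutout
open HodgeCM.PerL34.IdelicTorusModel HodgeCM.PerL34.IdelicTorusModel.Genuine HodgeCM.PerL34.PureTensor
attribute [local instance] LocalFactors.DilationModel.Adic.nontriviallyNormedField
  LocalFactors.DilationModel.Adic.properSpace
variable (L : Type) [Field L] [NumberField L] [IsCMField L]
section tensor
variable [DecidableEq (Place (maximalRealSubfield L))]
  [∀ v : HeightOneSpectrum (𝓞 (maximalRealSubfield L)), MeasurableSpace (v.adicCompletion (maximalRealSubfield L))]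
  [∀ v : HeightOneSpectrum (𝓞 (maximalRealSubfield L)), BorelSpace (v.adicCompletion (maximalRealSubfield L))]
  (S₀ : Finset (Place (maximalRealSubfield L)))
  {Sp : Type} [NormedAddCommGroup Sp] [InnerProductSpace ℂ Sp]
  {W : Type} [AddCommGroup W] [Module L W]
  {H Sbox : Type} [Group H] [AddCommGroup Sbox] [Module ℂ Sbox]
  {h : W →ₗ⋆[L] W →ₗ[L] L} (hW : IsLine L W) (hh : Anisotropic h)
  (D : DoublingDatum (Model L) H Sp Sbox) (GU : ThetaSide Sp Sbox)
  (j : isomBox h →* H) (hj : ∀ d : unitary L, j ⟨iotaSnd d, iotaSnd_mem h d⟩ = D.ι (1, unitaryToModel L d))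
  (χ : Model L →* Circle) (hχΓ : ∀ d : unitary L, χ (unitaryToModel L d) = 1)
  (hχVΓ : ∀ d : unitary L, D.χV (unitaryToModel L d) = 1)
  {hP : ∀ Ψ : Sbox, ∀ p ∈ (stabDelta L W).subgroupOf (isomBox h), ∀ x : H, D.fSW Ψ (j p * x) = D.fSW Ψ x}
  (P : GluePrintInputs D GU h j hP)
  (hloc : ∀ (i : Place (maximalRealSubfield L)) (v : Sp),
    Continuous fun g : locTorus (maximalRealSubfield L) L i => D.ω (RestrictedProduct.mulSingle (genLevel L) i g) v)
  {T' : Finset (Place (maximalRealSubfield L))}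
  (hχT' : RestrictedProduct.boxSubgroup (genLevel L) T' ≤ χ.ker)
  (hlocχ : ∀ i ∈ T', Continuous fun g : locTorus (maximalRealSubfield L) L i =>
    χ (RestrictedProduct.mulSingle (genLevel L) i g))
  {S : Finset (Place (maximalRealSubfield L))} (hT'S : T' ⊆ S)
  (hS : ∀ v : InfinitePlace (maximalRealSubfield L), Sum.inl v ∈ S)
  {ν : ∀ i : Place (maximalRealSubfield L),
    ((basePlaceOf L i).adicCompletion (maximalRealSubfield L))ˣ →* Circle}
  (hν : ∀ i, i ∉ S → IsSplitPlace L i →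
    ∀ u : ((basePlaceOf L i).adicCompletion (maximalRealSubfield L))ˣ,
      ‖(u : (basePlaceOf L i).adicCompletion (maximalRealSubfield L))‖ = 1 → ν i u = 1)
  (hνc : ∀ i, IsSplitPlace L i → Continuous (ν i))
  (x₀ : ∀ i : Place (maximalRealSubfield L), Fin 3 → (basePlaceOf L i).adicCompletion (maximalRealSubfield L))
  (hx₀ : ∀ i ∈ S, IsSplitPlace L i → x₀ i ≠ 0)
  (φ : Sp)
include hW hh hj hχΓ hχVΓ P hloc hT'S hS hν
set_option synthInstance.maxHeartbeats 200000 in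
/-- **… the hypothesis as an EULER PRODUCT.**  The same END with the one identity written
`⟪φ, D.ω g φ⟫ = ∏ᶠ_v ⟪φ•_v, ρ_v(g_v) φ•_v⟫` — the product of the GENUINE LOCAL coefficients (`ρ_v = locRep L χ ν v`:
the `ν_v`-twisted dilation representation of `(L⁺_v)ˣ ≅ T(L⁺_v)` on `H_v = L²((L⁺_v)³)` at split `v`, the scalar
character `conj χ_v` on `H_v` (only the line `ℂ · 1_{𝒪_v³}` matters) at non-split `v`; `φ•_v = phiFam … v`: the
normalised ball indicator `1_{x₀,v + ϖ^{n_v}𝒪_v³}` at split `v ∈ S`, the unit vector `e_v = 1_{𝒪_v³}` at every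
other `v`).  This is PerL v5 ll. 600–616 — "for a pure tensor
`φ = ⊗φ_v`, `⟨ω(y)φ, φ⟩ = ∏_v ⟨ω_v(y_v)φ_v, φ_v⟩`" — taken as the HYPOTHESIS on the datum: the weakest
representation-side interface of seam S3. -/
theorem exists_compactDomain_thetaLift_ne_zero_genuine_tensor_of_eulerProduct
    (hcoeff : ∀ g : Model L, ⟪φ, D.ω g φ⟫_ℂ =
      ∏ᶠ i, ⟪phiFam L S x₀ (radius L S hνc hχT' hlocχ x₀ hx₀) i,
        locRep L χ ν i (g i) (phiFam L S x₀ (radius L S hνc hχT' hlocχ x₀ hx₀) i)⟫_ℂ)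
    [IsFiniteMeasure GU.μ] :
    ∃ 𝓕 : Set (Model L), IsCompact 𝓕 ∧ (interior 𝓕).Nonempty ∧ MeasurableSet 𝓕 ∧
      IsFundamentalDomain (unitaryToModel L).range 𝓕
        (haarDatum (genLevel L) (isCompact_genLevel L) (isOpen_genLevel L) S₀).μ ∧
      (haarDatum (genLevel L) (isCompact_genLevel L) (isOpen_genLevel L) S₀).μ 𝓕 ≠ 0 ∧
      (haarDatum (genLevel L) (isCompact_genLevel L) (isOpen_genLevel L) S₀).μ 𝓕 ≠ ⊤ ∧
      ∀ [IsFiniteMeasure (((haarDatum (genLevel L) (isCompact_genLevel L) (isOpen_genLevel L) S₀).μ).restrict 𝓕)]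
        (hk : Measurable (Function.uncurry (thetaFn D GU φ))) {Ck : ℝ} (hCk : 0 ≤ Ck)
        (hkC : ∀ q u, ‖thetaFn D GU φ q u‖ ≤ Ck),
        PeterssonFubini.theta GU.μ
          (((haarDatum (genLevel L) (isCompact_genLevel L) (isOpen_genLevel L) S₀).μ).restrict 𝓕) hk
          (measurable_coe_char (genLevel L) (isOpen_genLevel L) χ hχT' hlocχ) hCk hkC (norm_coe_char_le χ) ≠ 0 :=
  exists_compactDomain_thetaLift_ne_zero_genuine_tensor_of_coeffMatch L S₀ hW hh D GU j hj χ hχΓ hχVΓ P hloc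
    hχT' hlocχ hT'S hS hν hνc x₀ hx₀ φ (fun g => by
      rw [hcoeff g, inner_tp_rep_tp (admissible L hν hχT') g (phiFam L S x₀ _) (phiFam L S x₀ _)])

/-! ## §5  Consistency: the kernel-map END of #2 without completeness -/

set_option synthInstance.maxHeartbeats 200000 in
/-- **the kernel-map END, no completeness.**  This seat's #2
`exists_compactDomain_thetaLift_ne_zero_genuine_tensor_of_kernelMap` asked `[CompleteSpace Sp]` (to extend the
kernel map to `⊗′H →ₗᵢ Sp` by the universal property).  By coefficient matching the same conclusion holds for a
datum on ANY inner-product space: a kernel map `(Φ, hΦ, hπ)` gives `⟪Φ φ•, D.ω g (Φ φ•)⟫ = ⟪Φ φ•, Φ (g • φ•)⟫ =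
∏_v ⟪φ•_v, ρ_v(g_v) φ•_v⟫ = ⟪φ•, ⊗′ρ(g) φ•⟫`. -/
theorem exists_compactDomain_thetaLift_ne_zero_genuine_tensor_of_kernelMap'
    (Φ : RVec (unitFam L) → Sp) (hΦ : ∀ x y, ⟪Φ x, Φ y⟫_ℂ = kfun x y)
    (hπ : ∀ (g : Model L) (x : RVec (unitFam L)), D.ω g (Φ x) = Φ (gact (admissible L hν hχT') g x))
    [IsFiniteMeasure GU.μ] :
    ∃ 𝓕 : Set (Model L), IsCompact 𝓕 ∧ (interior 𝓕).Nonempty ∧ MeasurableSet 𝓕 ∧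
      IsFundamentalDomain (unitaryToModel L).range 𝓕
        (haarDatum (genLevel L) (isCompact_genLevel L) (isOpen_genLevel L) S₀).μ ∧
      (haarDatum (genLevel L) (isCompact_genLevel L) (isOpen_genLevel L) S₀).μ 𝓕 ≠ 0 ∧
      (haarDatum (genLevel L) (isCompact_genLevel L) (isOpen_genLevel L) S₀).μ 𝓕 ≠ ⊤ ∧
      ∀ [IsFiniteMeasure (((haarDatum (genLevel L) (isCompact_genLevel L) (isOpen_genLevel L) S₀).μ).restrict 𝓕)]
        (hk : Measurable (Function.uncurry
          (thetaFn D GU (Φ (phiFam L S x₀ (radius L S hνc hχT' hlocχ x₀ hx₀)))))) {Ck : ℝ} (hCk : 0 ≤ Ck)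
        (hkC : ∀ q u, ‖thetaFn D GU (Φ (phiFam L S x₀ (radius L S hνc hχT' hlocχ x₀ hx₀))) q u‖ ≤ Ck),
        PeterssonFubini.theta GU.μ
          (((haarDatum (genLevel L) (isCompact_genLevel L) (isOpen_genLevel L) S₀).μ).restrict 𝓕) hk
          (measurable_coe_char (genLevel L) (isOpen_genLevel L) χ hχT' hlocχ) hCk hkC (norm_coe_char_le χ) ≠ 0 :=
  exists_compactDomain_thetaLift_ne_zero_genuine_tensor_of_coeffMatch L S₀ hW hh D GU j hj χ hχΓ hχVΓ P hloc
    hχT' hlocχ hT'S hS hν hνc x₀ hx₀ _ (fun g => by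
      rw [hπ, hΦ, rep_tp (admissible L hν hχT') g (phiFam L S x₀ _), inner_tp_tp])

end tensor

end HodgeCM.PerL34.RestrictedTensor.Genuine

end
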